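import Mathlib
import Summits.Ventures.PercRepro2.UniversalSPEquiv

/-! # `SP.Equiv` and lists of factors
(seat mine-b, cell pub-perc-repro2; MINE-B.md §26.7)

A series (parallel) composition of a nonempty list of terms, left-nested (`SP.serL`, `SP.parL`), is
`SP.Equiv`-invariant under permutations of the list (`SP.Equiv.serL_perm`, `SP.Equiv.parL_perm`),
splits along `++` (`SP.Equiv.serL_append`, `SP.Equiv.parL_append`), and every term is equivalent to
the composition of its list of factors (`SP.Equiv.serL_serFactors`, `SP.Equiv.parL_parFactors`) —
the plumbing behind a normal form for terms up to bracketing and order. -/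

namespace Summit.Ventures.PercRepro2.V2Closure

open Summit.Ventures.PercRepro2.UHClosure

/-- the series composition of `s` with a list of further factors, left-nested -/
def SP.serL (s : SP) (l : List SP) : SP := l.foldl SP.ser s

/-- the parallel composition of `s` with a list of further factors, left-nested -/
def SP.parL (s : SP) (l : List SP) : SP := l.foldl SP.par s

/-- the series composition with no further factor -/
@[simp] theorem SP.serL_nil (s : SP) : SP.serL s [] = s := rfl
/-- the series composition absorbs the first factor into the head -/
@[simp] theorem SP.serL_cons (s a : SP) (l : List SP) : SP.serL s (a :: l) = SP.serL (SP.ser s a) l := rfl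
/-- the parallel composition with no further factor -/
@[simp] theorem SP.parL_nil (s : SP) : SP.parL s [] = s := rfl
/-- the parallel composition absorbs the first factor into the head -/
@[simp] theorem SP.parL_cons (s a : SP) (l : List SP) : SP.parL s (a :: l) = SP.parL (SP.par s a) l := rfl

/-- the series factors of a term (a `ser` node flattened, any other term a single factor) -/
def SP.serFactors : SP → List SP
  | .ser s t => s.serFactors ++ t.serFactors
  | s => [s]

/-- the parallel factors of a term -/
def SP.parFactors : SP → List SP
  | .par s t => s.parFactors ++ t.parFactors
  | s => [s]

/-- `serL` respects `SP.Equiv` in its head -/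
theorem SP.Equiv.serL_congr_head {s s' : SP} (h : SP.Equiv s s') (l : List SP) :
    SP.Equiv (SP.serL s l) (SP.serL s' l) := by
  induction l generalizing s s' with
  | nil => exact h
  | cons a l ih => exact ih (SP.Equiv.ser_congr h (SP.Equiv.refl a))

/-- `parL` respects `SP.Equiv` in its head -/
theorem SP.Equiv.parL_congr_head {s s' : SP} (h : SP.Equiv s s') (l : List SP) :
    SP.Equiv (SP.parL s l) (SP.parL s' l) := by
  induction l generalizing s s' with
  | nil => exact h
  | cons a l ih => exact ih (SP.Equiv.par_congr h (SP.Equiv.refl a))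

/-- `serL` respects `SP.Equiv` in every factor -/
theorem SP.Equiv.serL_congr {s s' : SP} (h : SP.Equiv s s') {l l' : List SP}
    (hl : List.Forall₂ SP.Equiv l l') : SP.Equiv (SP.serL s l) (SP.serL s' l') := by
  induction hl generalizing s s' with
  | nil => exact h
  | cons hab _ ih => exact ih (SP.Equiv.ser_congr h hab)

/-- `parL` respects `SP.Equiv` in every factor -/
theorem SP.Equiv.parL_congr {s s' : SP} (h : SP.Equiv s s') {l l' : List SP}
    (hl : List.Forall₂ SP.Equiv l l') : SP.Equiv (SP.parL s l) (SP.parL s' l') := by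
  induction hl generalizing s s' with
  | nil => exact h
  | cons hab _ ih => exact ih (SP.Equiv.par_congr h hab)

/-- swapping the two factors next to the head -/
theorem SP.Equiv.ser_ser_swap (s a b : SP) : SP.Equiv (SP.ser (SP.ser s a) b) (SP.ser (SP.ser s b) a) :=
  (SP.Equiv.ser_assoc s a b).trans ((SP.Equiv.ser_congr (SP.Equiv.refl s) (SP.Equiv.ser_comm a b)).trans
    (SP.Equiv.ser_assoc s b a).symm)

/-- swapping the two factors next to the head -/
theorem SP.Equiv.par_par_swap (s a b : SP) : SP.Equiv (SP.par (SP.par s a) b) (SP.par (SP.par s b) a) :=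
  (SP.Equiv.par_assoc s a b).trans ((SP.Equiv.par_congr (SP.Equiv.refl s) (SP.Equiv.par_comm a b)).trans
    (SP.Equiv.par_assoc s b a).symm)

/-- **a permutation of the factors gives an equivalent series composition** -/
theorem SP.Equiv.serL_perm (s : SP) {l l' : List SP} (h : l.Perm l') : SP.Equiv (SP.serL s l) (SP.serL s l') := by
  induction h generalizing s with
  | nil => exact SP.Equiv.refl _
  | cons a _ ih => exact ih (SP.ser s a)
  | swap a b l => exact SP.Equiv.serL_congr_head (SP.Equiv.ser_ser_swap s b a) l
  | trans _ _ ih₁ ih₂ => exact (ih₁ s).trans (ih₂ s)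

/-- **a permutation of the factors gives an equivalent parallel composition** -/
theorem SP.Equiv.parL_perm (s : SP) {l l' : List SP} (h : l.Perm l') : SP.Equiv (SP.parL s l) (SP.parL s l') := by
  induction h generalizing s with
  | nil => exact SP.Equiv.refl _
  | cons a _ ih => exact ih (SP.par s a)
  | swap a b l => exact SP.Equiv.parL_congr_head (SP.Equiv.par_par_swap s b a) l
  | trans _ _ ih₁ ih₂ => exact (ih₁ s).trans (ih₂ s)

/-- re-associating a left-nested composition under a head -/
theorem SP.Equiv.serL_ser (s a : SP) (l : List SP) : SP.Equiv (SP.serL (SP.ser s a) l) (SP.ser s (SP.serL a l)) := by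
  induction l generalizing s a with
  | nil => exact SP.Equiv.refl _
  | cons b l ih =>
    show SP.Equiv (SP.serL (SP.ser (SP.ser s a) b) l) (SP.ser s (SP.serL (SP.ser a b) l))
    exact (SP.Equiv.serL_congr_head (SP.Equiv.ser_assoc s a b) l).trans (ih s (SP.ser a b))

/-- re-associating a left-nested composition under a head -/
theorem SP.Equiv.parL_par (s a : SP) (l : List SP) : SP.Equiv (SP.parL (SP.par s a) l) (SP.par s (SP.parL a l)) := by
  induction l generalizing s a with
  | nil => exact SP.Equiv.refl _
  | cons b l ih =>
    show SP.Equiv (SP.parL (SP.par (SP.par s a) b) l) (SP.par s (SP.parL (SP.par a b) l))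
    exact (SP.Equiv.parL_congr_head (SP.Equiv.par_assoc s a b) l).trans (ih s (SP.par a b))

/-- **the composition of an appended list of factors is the composition of the two parts** -/
theorem SP.Equiv.serL_append (s a : SP) (l l' : List SP) :
    SP.Equiv (SP.serL s (l ++ a :: l')) (SP.ser (SP.serL s l) (SP.serL a l')) := by
  unfold SP.serL
  rw [List.foldl_append]
  exact SP.Equiv.serL_ser _ a l'

/-- **the composition of an appended list of factors is the composition of the two parts** -/
theorem SP.Equiv.parL_append (s a : SP) (l l' : List SP) :
    SP.Equiv (SP.parL s (l ++ a :: l')) (SP.par (SP.parL s l) (SP.parL a l')) := by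
  unfold SP.parL
  rw [List.foldl_append]
  exact SP.Equiv.parL_par _ a l'

/-- the series factors of a term form a nonempty list -/
theorem SP.serFactors_ne_nil (s : SP) : s.serFactors ≠ [] := by
  induction s with
  | ser s t ihs _ => simp only [SP.serFactors, ne_eq, List.append_eq_nil_iff, not_and]; exact fun h => (ihs h).elim
  | free => simp [SP.serFactors]
  | pin => simp [SP.serFactors]
  | absent => simp [SP.serFactors]
  | par s t _ _ => simp [SP.serFactors]

/-- the parallel factors of a term form a nonempty list -/
theorem SP.parFactors_ne_nil (s : SP) : s.parFactors ≠ [] := by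
  induction s with
  | par s t ihs _ => simp only [SP.parFactors, ne_eq, List.append_eq_nil_iff, not_and]; exact fun h => (ihs h).elim
  | free => simp [SP.parFactors]
  | pin => simp [SP.parFactors]
  | absent => simp [SP.parFactors]
  | ser s t _ _ => simp [SP.parFactors]

/-- **every term is equivalent to the series composition of its series factors** (for any way of
writing the factor list as `a :: l`) -/
theorem SP.Equiv.serL_serFactors (s : SP) {a : SP} {l : List SP} (h : s.serFactors = a :: l) :
    SP.Equiv s (SP.serL a l) := by
  induction s generalizing a l with
  | ser s t ihs iht =>
    simp only [SP.serFactors] at h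
    obtain ⟨b, lb, hb⟩ := List.exists_cons_of_ne_nil (SP.serFactors_ne_nil s)
    obtain ⟨c, lc, hc⟩ := List.exists_cons_of_ne_nil (SP.serFactors_ne_nil t)
    rw [hb, hc] at h
    simp only [List.cons_append, List.cons.injEq] at h
    obtain ⟨rfl, rfl⟩ := h
    exact (SP.Equiv.ser_congr (ihs hb) (iht hc)).trans (SP.Equiv.serL_append b c lb lc).symm
  | free => simp only [SP.serFactors, List.cons.injEq] at h; obtain ⟨rfl, rfl⟩ := h; exact SP.Equiv.refl _
  | pin => simp only [SP.serFactors, List.cons.injEq] at h; obtain ⟨rfl, rfl⟩ := h; exact SP.Equiv.refl _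
  | absent => simp only [SP.serFactors, List.cons.injEq] at h; obtain ⟨rfl, rfl⟩ := h; exact SP.Equiv.refl _
  | par s t _ _ => simp only [SP.serFactors, List.cons.injEq] at h; obtain ⟨rfl, rfl⟩ := h; exact SP.Equiv.refl _

/-- **every term is equivalent to the parallel composition of its parallel factors** -/
theorem SP.Equiv.parL_parFactors (s : SP) {a : SP} {l : List SP} (h : s.parFactors = a :: l) :
    SP.Equiv s (SP.parL a l) := by
  induction s generalizing a l with
  | par s t ihs iht =>
    simp only [SP.parFactors] at h
    obtain ⟨b, lb, hb⟩ := List.exists_cons_of_ne_nil (SP.parFactors_ne_nil s)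
    obtain ⟨c, lc, hc⟩ := List.exists_cons_of_ne_nil (SP.parFactors_ne_nil t)
    rw [hb, hc] at h
    simp only [List.cons_append, List.cons.injEq] at h
    obtain ⟨rfl, rfl⟩ := h
    exact (SP.Equiv.par_congr (ihs hb) (iht hc)).trans (SP.Equiv.parL_append b c lb lc).symm
  | free => simp only [SP.parFactors, List.cons.injEq] at h; obtain ⟨rfl, rfl⟩ := h; exact SP.Equiv.refl _
  | pin => simp only [SP.parFactors, List.cons.injEq] at h; obtain ⟨rfl, rfl⟩ := h; exact SP.Equiv.refl _
  | absent => simp only [SP.parFactors, List.cons.injEq] at h; obtain ⟨rfl, rfl⟩ := h; exact SP.Equiv.refl _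
  | ser s t _ _ => simp only [SP.parFactors, List.cons.injEq] at h; obtain ⟨rfl, rfl⟩ := h; exact SP.Equiv.refl _

/-- **(UH*) for a series composition of sorted factors**: sorting the factor list (any comparison)
keeps (UH*) — `List.mergeSort_perm` -/
theorem SP.universal_serL_mergeSort (s : SP) (l : List SP) (le : SP → SP → Bool)
    (h : Universal (SP.serL s l).rLab (SP.serL s l).bLab) :
    Universal (SP.serL s (l.mergeSort le)).rLab (SP.serL s (l.mergeSort le)).bLab :=
  SP.universal_of_equiv (SP.Equiv.serL_perm s (List.mergeSort_perm l le).symm) h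

end Summit.Ventures.PercRepro2.V2Closure
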